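import Literature.NumberTheory.EllipticCurves.FormalGroupLawPointwiseProofs
import HarnessLib

/-!
# The formal group law computes the group law on `E₁(ℚ_p)` (Silverman AEC IV.1 / VII.2.2):
# discharge of `WeierstrassCurve.formalGroupLaw_padicEval` (θ₃)

Trunk T-NT-EC (Literature/NumberTheory/EllipticCurves); fifth proof file behind the named fact
`WeierstrassCurve.exists_isCanonical`. `CanonicalPAdicHeightThetaProofs.lean` reduced the
existence of the canonical `p`-adic height to three named facts: the Mazur–Tate pair exists
(θ₁), the formal theta identity (θ₂), and θ₃ = `formalGroupLaw_padicEval`: for an elliptic curve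
over `ℚ_p` with `p`-integral Weierstrass equation and `P, Q ∈ E₁(ℚ_p)`,
`F(z(P), z(Q)) = z(P + Q)` where `F = i(z₃(z₁, z₂))` is the chord–tangent formal group law of
`FormalGroupLaw.lean` (AEC IV.1) and `+` is Mathlib's addition of points. This file PROVES θ₃
(`formalGroupLaw_padicEval_holds`), so that afterwards

  `exists_isCanonical ⟸ mazur_tate_sigma_existsUnique ∧ padicSigma_theta_formal`

(`exists_isCanonical_of_MT_theta`).

## Proof architecture (everything at POINTS, via the evaluation homomorphism)

Write `u = z(P)`, `v = z(Q)`, `wᵢ = w(Pᵢ) = -1/yᵢ` (= `ŵ(zᵢ)` by the dictionary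
`padicEval_formalW_eq`), and `λ̂, ν̂, ĉ₃ = 1 + a₂λ̂ + a₄λ̂² + a₆λ̂³, ĉ₂, ẑ₃` for the values at
`(u, v)` of the formal slope, intercept, chord-cubic coefficients and third root
(`padicEval₂_formalSlope_mul_sub`, `…_formalIntercept`, `…_formalChordZ`: evaluation is a ring
homomorphism commuting with substitution, `PadicSeriesEvaluation.lean`). Then:
1. *Both points lie on the `(z,w)`-line* `w = λ̂z + ν̂` (chord property `λ(z₂-z₁) = w(z₂)-w(z₁)`
   evaluated), i.e. `ν̂yᵢ = λ̂xᵢ - 1` in the `(x,y)`-chart (`line_xy_iff_line_zw`).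
2. *The `(x,y)`-line through `P, Q` has slope `λ̂/ν̂` and `ν̂ ≠ 0`* — for a chord directly from
   1.; for the TANGENT (`P = Q`) through `λ(z,z) = w'(z)` (`formalSlope_diag`) and the derivative
   dictionary `ŵ'·(zF_x - F_y) = wF_x` (`padicEval_derivative_formalW_mul`, from implicit
   differentiation of the fixed point `w = f(z,w)`, `derivative_formalW`).
3. *Chart transfer*: Mathlib's `addPolynomial_slope` factors the Weierstrass polynomial on the
   `(x,y)`-line as `-(X-x₁)(X-x₂)(X-x₃)`; dividing the equation by `y³` (`chart_identity`) turns
   this into `f(T, λ̂T+ν̂) - (λ̂T+ν̂) = ∏((1-λ̂xᵢ)T - ν̂xᵢ)` for all `T` off one value, hence as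
   polynomials (`Polynomial.eq_zero_of_infinite_isRoot`): `ĉ₃ = ∏(1-λ̂xᵢ)`,
   `ĉ₂ = -Σ ν̂xᵢ∏_{j≠i}(1-λ̂xⱼ)` (`chord_coeffs_of_xy_factorisation`).
4. *Vieta*: with `1 - λ̂xᵢ = -ν̂yᵢ`, `z(P) + z(Q) + z(R) = -ĉ₂/ĉ₃` (`chord_vieta`), i.e. the third
   intersection `R` has `z(R) = ẑ₃`; `ĉ₃ ≠ 0` because `‖λ̂‖ < 1` (`chordDenom_ne_zero`), which also
   forces `y(R) ≠ 0` and then `R ∈ E₁(ℚ_p)` (`‖w(R)‖ = ‖λ̂ẑ₃ + ν̂‖ < 1`).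
5. `z(P + Q) = z(-R) = i(z(R)) = i(ẑ₃) = F(u, v)` by the dictionary `padicEval_formalNeg_eq`.
6. *Degenerate chords through the origin* (`P = O`, `Q = O`, `Q = -P`): `ν̂ = 0`, the cubic is
   `T(ĉ₃T² + ĉ₂T - λ̂)` and the third root is `z(-S)` for the affine point `S` on it
   (`origin_third_root`; when `S = -S` — possible in `E₁(ℚ₂)` — the root is double, by the
   derivative dictionary again, `chord_origin_double`).

## Sources

* J. H. Silverman, *The Arithmetic of Elliptic Curves*, 2nd ed. (2009), IV.1 pp. 115–118
  (the `(z,w)`-plane, `w = f(z,w)`, `λ`, `ν`, "substituting … gives a cubic in `z`, two of whose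
  roots are `z₁` and `z₂`", `z₃`, `F(z₁,z₂) = i(z₃)`), III.2.3 (chord–tangent law), VII.2.2
  (`E₁(K) ≅ Ê(𝓜)`).

## Design notes

* No formal-group axiom for `F` is used or proved: associativity etc. are not needed for
  `F(z(P), z(Q)) = z(P + Q)`, which is established pairwise.
* The tangent and `2`-torsion cases are exactly where Silverman's "two of whose roots are `z₁`
  and `z₂`" needs multiplicities; they are supplied by `λ(z,z) = w'(z)` and implicit
  differentiation, never by a limiting argument.
-/

noncomputable section

open scoped Classical
open PowerSeries Literature.NumberTheory.EllipticCurves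

namespace WeierstrassCurve

/-! ### The main computation on `E₁(ℚ_p)` -/

section Main

variable {p : ℕ} [Fact p.Prime] (V : WeierstrassCurve ℚ_[p]) [hV : V.IsIntegral ℤ_[p]]

/-- On a `p`-integral equation, `‖y‖ > 1` forces `‖x‖ > 1` (the `y²` term dominates the left
side). [Silverman AEC VII.2.2 proof] [folklore] -/
theorem one_lt_norm_x_of_one_lt_norm_y {x y : ℚ_[p]} (heq : V.toAffine.Equation x y)
    (hy : 1 < ‖y‖) : 1 < ‖x‖ := by
  obtain ⟨h₁, h₂, h₃, h₄, h₆⟩ := V.norm_coeffs_le_one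
  by_contra hx
  push Not at hx
  rw [Affine.equation_iff] at heq
  change y ^ 2 + V.a₁ * x * y + V.a₃ * y = x ^ 3 + V.a₂ * x ^ 2 + V.a₄ * x + V.a₆ at heq
  have hy0 : 0 < ‖y‖ := one_pos.trans hy
  have hR : ‖x ^ 3 + V.a₂ * x ^ 2 + V.a₄ * x + V.a₆‖ ≤ 1 := by
    refine (Padic.nonarchimedean _ _).trans (max_le ((Padic.nonarchimedean _ _).trans (max_le
      ((Padic.nonarchimedean _ _).trans (max_le ?_ ?_)) ?_)) h₆)
    · rw [norm_pow]; exact pow_le_one₀ (norm_nonneg _) hx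
    · rw [norm_mul, norm_pow]
      exact mul_le_one₀ h₂ (by positivity) (pow_le_one₀ (norm_nonneg _) hx)
    · rw [norm_mul]; exact mul_le_one₀ h₄ (norm_nonneg _) hx
  have hl : ‖V.a₁ * x * y + V.a₃ * y‖ < ‖y‖ ^ 2 := by
    have hyy : ‖y‖ < ‖y‖ ^ 2 := by nlinarith
    refine (Padic.nonarchimedean _ _).trans_lt (max_lt ?_ ?_)
    · rw [norm_mul, norm_mul]
      calc ‖V.a₁‖ * ‖x‖ * ‖y‖ ≤ 1 * 1 * ‖y‖ := by gcongr
        _ = ‖y‖ := by ring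
        _ < ‖y‖ ^ 2 := hyy
    · rw [norm_mul]
      calc ‖V.a₃‖ * ‖y‖ ≤ 1 * ‖y‖ := by gcongr
        _ = ‖y‖ := by ring
        _ < ‖y‖ ^ 2 := hyy
  have hL : ‖y ^ 2 + V.a₁ * x * y + V.a₃ * y‖ = ‖y‖ ^ 2 := by
    rw [add_assoc, Padic.add_eq_max_of_ne, norm_pow, max_eq_left hl.le]
    rw [norm_pow]; exact (ne_of_lt hl).symm
  have hy2 : ‖y‖ ^ 2 ≤ 1 := by rw [← hL, heq]; exact hR
  nlinarith

omit hV in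
/-- The line relation in the two charts: `w = λz + ν` iff `νy = λx - 1` (`z = -x/y`,
`w = -1/y`, `y ≠ 0`). [folklore] -/
theorem _root_.Literature.NumberTheory.EllipticCurves.line_xy_iff_line_zw {x y L N : ℚ_[p]}
    (hy : y ≠ 0) : N * y = L * x - 1 ↔ -1 / y = L * (-x / y) + N := by
  constructor
  · intro h
    field_simp
    linear_combination -h
  · intro h
    field_simp at h
    linear_combination -h

variable {V}

/-- The leading coefficient `1 + a₂λ̂ + a₄λ̂² + a₆λ̂³` does not vanish at points of the open unit
disc (`‖λ̂‖ < 1`). [folklore] -/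
theorem chordDenom_ne_zero {u v : ℚ_[p]} (hu : ‖u‖ < 1) (hv : ‖v‖ < 1) :
    1 + V.a₂ * padicEval₂ V.formalSlope u v + V.a₄ * padicEval₂ V.formalSlope u v ^ 2 +
      V.a₆ * padicEval₂ V.formalSlope u v ^ 3 ≠ 0 := by
  obtain ⟨-, h₂, -, h₄, h₆⟩ := V.norm_coeffs_le_one
  have hL : ‖padicEval₂ V.formalSlope u v‖ < 1 :=
    norm_padicEval₂_lt_one V.isPadicInt_formalSlope V.constantCoeff_formalSlope hu hv
  set L := padicEval₂ V.formalSlope u v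
  have hs : ‖V.a₂ * L + V.a₄ * L ^ 2 + V.a₆ * L ^ 3‖ < 1 := by
    refine padic_norm_add_lt_one (padic_norm_add_lt_one (padic_norm_mul_lt_one h₂ hL) ?_) ?_
    · exact padic_norm_mul_lt_one h₄ (by rw [norm_pow]; exact pow_lt_one₀ (norm_nonneg _) hL two_ne_zero)
    · exact padic_norm_mul_lt_one h₆ (by rw [norm_pow]; exact pow_lt_one₀ (norm_nonneg _) hL three_ne_zero)
  intro h0
  have : V.a₂ * L + V.a₄ * L ^ 2 + V.a₆ * L ^ 3 = -1 := by linear_combination h0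
  rw [this, norm_neg, norm_one] at hs
  exact lt_irrefl _ hs

/-- **The generic case (`P ≠ -Q`), with membership of the sum**: for affine `P, Q ∈ E₁(ℚ_p)`,
`‖x(P + Q)‖ > 1` and `F(z(P), z(Q)) = z(P + Q)`.
The third intersection `R` of the line `PQ` with `E`, read in the `(z,w)`-chart, is the third
root `z₃(z(P), z(Q))` of the chord cubic (chart transfer of Mathlib's `addPolynomial_slope` and
Vieta), and `z(P + Q) = z(-R) = i(z(R))`. The tangent case `P = Q` uses `λ(z,z) = w'(z)` and the
derivative dictionary. [Silverman AEC IV.1 (pp. 116–118), VII.2.2] [folklore] -/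
theorem padicEval₂_formalGroupLaw_of_not_neg_aux {x₁ y₁ x₂ y₂ : ℚ_[p]}
    (h₁ : V.toAffine.Nonsingular x₁ y₁) (h₂ : V.toAffine.Nonsingular x₂ y₂) (hx₁ : 1 < ‖x₁‖)
    (hx₂ : 1 < ‖x₂‖) (hxy : ¬(x₁ = x₂ ∧ y₁ = V.toAffine.negY x₂ y₂)) :
    1 < ‖V.toAffine.addX x₁ x₂ (V.toAffine.slope x₁ x₂ y₁ y₂)‖ ∧
      padicEval₂ V.formalGroupLaw (-x₁ / y₁) (-x₂ / y₂) =
        V.formalParameter (.some x₁ y₁ h₁ + .some x₂ y₂ h₂) := by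
  obtain ⟨ha₁, ha₂, ha₃, ha₄, ha₆⟩ := V.norm_coeffs_le_one
  obtain ⟨hy₁, hu0, hu1, -, -⟩ := V.param_facts h₁.1 hx₁
  obtain ⟨hy₂, hv0, hv1, -, -⟩ := V.param_facts h₂.1 hx₂
  set u : ℚ_[p] := -x₁ / y₁ with hudef
  set v : ℚ_[p] := -x₂ / y₂ with hvdef
  set L := padicEval₂ V.formalSlope u v with hLdef
  set N := padicEval₂ V.formalIntercept u v with hNdef
  have hwu : padicEval V.formalW u = -1 / y₁ := V.padicEval_formalW_eq h₁.1 hx₁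
  have hwv : padicEval V.formalW v = -1 / y₂ := V.padicEval_formalW_eq h₂.1 hx₂
  have hN : N = -1 / y₁ - L * u := by rw [hNdef, padicEval₂_formalIntercept hu1 hv1, hwu]
  have hchord : L * (v - u) = -1 / y₂ - -1 / y₁ := by
    rw [← hwu, ← hwv]; exact padicEval₂_formalSlope_mul_sub hu1 hv1
  -- both points lie on the `(z,w)`-line `w = Lz + N`
  have hPw : -1 / y₁ = L * u + N := by rw [hN]; ring
  have hQw : -1 / y₂ = L * v + N := by rw [hN]; linear_combination -hchord
  have hP : N * y₁ = L * x₁ - 1 := (line_xy_iff_line_zw hy₁).mpr hPw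
  have hQ : N * y₂ = L * x₂ - 1 := (line_xy_iff_line_zw hy₂).mpr hQw
  have hc3 := chordDenom_ne_zero (V := V) hu1 hv1
  rw [← hLdef] at hc3
  -- the slope of the `(x,y)`-line is `L/N`
  have hNL : N ≠ 0 ∧ V.toAffine.slope x₁ x₂ y₁ y₂ = L / N := by
    by_cases hx : x₁ = x₂
    · -- tangent case: `P = Q`
      have hy : y₁ ≠ V.toAffine.negY x₂ y₂ := fun h => hxy ⟨hx, h⟩
      have hyy : y₁ = y₂ := Affine.Y_eq_of_Y_ne h₁.1 h₂.1 hx hy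
      have huv : v = u := by rw [hudef, hvdef, hx, hyy]
      have hLd : L = padicEval (d⁄dX ℚ_[p] V.formalW) u := by
        rw [hLdef, huv]; exact padicEval₂_formalSlope_diag hu1
      have hder := V.padicEval_derivative_formalW_mul h₁.1 hx₁
      rw [← hudef, ← hLd] at hder
      have hFy : 2 * y₁ + V.a₁ * x₁ + V.a₃ ≠ 0 := by
        intro h0; apply hy; rw [← hx, ← hyy, Affine.negY]; linear_combination h0
      have hdag : N * (V.a₁ * y₁ - 3 * x₁ ^ 2 - 2 * V.a₂ * x₁ - V.a₄) =
          -(L * (2 * y₁ + V.a₁ * x₁ + V.a₃)) := by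
        rw [hN]; linear_combination -hder
      have hN0 : N ≠ 0 := by
        intro h0
        rw [h0, zero_mul, zero_eq_neg, mul_eq_zero] at hdag
        rcases hdag with hL0 | hF0
        · apply hy₁
          have : (-1 : ℚ_[p]) / y₁ = 0 := by rw [hPw, h0, hL0, zero_mul, add_zero]
          simpa using this
        · exact hFy hF0
      refine ⟨hN0, ?_⟩
      rw [Affine.slope_of_Y_ne hx hy, Affine.negY]
      have hFy' : y₁ - (-y₁ - V.toAffine.a₁ * x₁ - V.toAffine.a₃) ≠ 0 := by
        intro h0; apply hFy; linear_combination h0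
      rw [div_eq_div_iff hFy' hN0]
      linear_combination -hdag
    · -- chord case
      have key : N * (y₁ - y₂) = L * (x₁ - x₂) := by linear_combination hP - hQ
      have hN0 : N ≠ 0 := by
        intro h0
        rw [h0, zero_mul] at key
        have hL0 : L = 0 := (mul_eq_zero.mp key.symm).resolve_right (sub_ne_zero.mpr hx)
        rw [h0, hL0, zero_mul, zero_mul, zero_sub] at hP
        exact one_ne_zero (neg_eq_zero.mp hP.symm)
      refine ⟨hN0, ?_⟩
      rw [Affine.slope_of_X_ne hx]
      field_simp
      linear_combination key
  obtain ⟨hN0, hslope⟩ := hNL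
  -- Mathlib's third intersection `R = (x₃, y₃)` and the chord factorisation
  set ℓ := V.toAffine.slope x₁ x₂ y₁ y₂ with hℓ
  set x₃ := V.toAffine.addX x₁ x₂ ℓ with hx₃
  set y₃ := V.toAffine.negAddY x₁ x₂ y₁ ℓ with hy₃def
  have heq₃ : V.toAffine.Equation x₃ y₃ := Affine.equation_negAdd h₁.1 h₂.1 hxy
  have hfac : ∀ X : ℚ_[p],
      (L / N * (X - x₁) + y₁) ^ 2 + V.a₁ * X * (L / N * (X - x₁) + y₁) +
          V.a₃ * (L / N * (X - x₁) + y₁) - (X ^ 3 + V.a₂ * X ^ 2 + V.a₄ * X + V.a₆) =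
        -((X - x₁) * (X - x₂) * (X - x₃)) := by
    intro X
    have h := congrArg (Polynomial.eval X) (Affine.addPolynomial_slope h₁.1 h₂.1 hxy)
    rw [Affine.addPolynomial_eq] at h
    simp only [Cubic.toPoly, Polynomial.eval_neg, Polynomial.eval_add, Polynomial.eval_mul,
      Polynomial.eval_pow, Polynomial.eval_C, Polynomial.eval_X, Polynomial.eval_sub] at h
    rw [← hℓ, ← hx₃, hslope] at h
    linear_combination h
  have hR : N * y₃ = L * x₃ - 1 := by
    have : y₃ = ℓ * (x₃ - x₁) + y₁ := by rw [hy₃def]; rfl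
    rw [this, hslope]
    field_simp
    linear_combination hP
  have hy₃ : y₃ ≠ 0 := V.y_ne_zero_of_chord_coeff_ne_zero hN0 hP hR hfac hc3
  have hvieta := V.chord_vieta hN0 hy₁ hy₂ hy₃ hP hQ hR hfac
  -- the third root is `z(R)`
  have hz3 : padicEval₂ V.formalChordZ u v = -x₃ / y₃ := by
    rw [padicEval₂_formalChordZ hu1 hv1, padicEval₂_formalChordNum hu1 hv1,
      padicEval₂_formalChordDenom hu1 hv1, ← hLdef, ← hNdef, hudef, hvdef, ← div_eq_mul_inv]
    have h' : -x₁ / y₁ + -x₂ / y₂ + -x₃ / y₃ =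
        -(V.a₁ * L + V.a₂ * N + V.a₃ * L ^ 2 + 2 * V.a₄ * L * N + 3 * V.a₆ * L ^ 2 * N) /
          (1 + V.a₂ * L + V.a₄ * L ^ 2 + V.a₆ * L ^ 3) := by
      rw [eq_div_iff hc3]; linear_combination hvieta
    linear_combination -h'
  -- `R ∈ E₁(ℚ_p)`
  have hz3n : ‖padicEval₂ V.formalChordZ u v‖ < 1 :=
    norm_padicEval₂_lt_one V.isPadicInt_formalChordZ V.constantCoeff_formalChordZ hu1 hv1
  have hNn : ‖N‖ < 1 :=
    norm_padicEval₂_lt_one V.isPadicInt_formalIntercept V.constantCoeff_formalIntercept hu1 hv1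
  have hLn : ‖L‖ ≤ 1 := norm_padicEval₂_le_one V.isPadicInt_formalSlope hu1 hv1
  have hwR : -1 / y₃ = L * (-x₃ / y₃) + N := (line_xy_iff_line_zw hy₃).mp hR
  have hy₃n : 1 < ‖y₃‖ := by
    have h : ‖-1 / y₃‖ < 1 := by
      rw [hwR, ← hz3]; exact padic_norm_add_lt_one (padic_norm_mul_lt_one hLn hz3n) hNn
    rw [norm_div, norm_neg, norm_one, div_lt_one (norm_pos_iff.mpr hy₃)] at h
    exact h
  have hx₃n : 1 < ‖x₃‖ := V.one_lt_norm_x_of_one_lt_norm_y heq₃ hy₃n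
  -- conclusion
  refine ⟨hx₃n, ?_⟩
  rw [Affine.Point.add_some hxy]
  show padicEval₂ V.formalGroupLaw u v = -(V.toAffine.addX x₁ x₂ ℓ) / V.toAffine.addY x₁ x₂ y₁ ℓ
  rw [padicEval₂_formalGroupLaw hu1 hv1, hz3, V.padicEval_formalNeg_eq heq₃ hx₃n]
  rfl

/-- **The generic case (`P ≠ -Q`): `F(z(P), z(Q)) = z(P + Q)`** for affine `P, Q ∈ E₁(ℚ_p)`.
[Silverman AEC IV.1 (pp. 116–118), VII.2.2] [folklore] -/
theorem padicEval₂_formalGroupLaw_of_not_neg {x₁ y₁ x₂ y₂ : ℚ_[p]}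
    (h₁ : V.toAffine.Nonsingular x₁ y₁) (h₂ : V.toAffine.Nonsingular x₂ y₂) (hx₁ : 1 < ‖x₁‖)
    (hx₂ : 1 < ‖x₂‖) (hxy : ¬(x₁ = x₂ ∧ y₁ = V.toAffine.negY x₂ y₂)) :
    padicEval₂ V.formalGroupLaw (-x₁ / y₁) (-x₂ / y₂) =
      V.formalParameter (.some x₁ y₁ h₁ + .some x₂ y₂ h₂) :=
  (padicEval₂_formalGroupLaw_of_not_neg_aux h₁ h₂ hx₁ hx₂ hxy).2

/-- **`E₁(ℚ_p)` is closed under the group law** (for an integral equation): if `P, Q ∈ E₁(ℚ_p)`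
then `P + Q ∈ E₁(ℚ_p)` — the third intersection of the chord lies in `E₁` because its
`(z,w)`-coordinates are small (`z(R) = z₃`, `w(R) = λ̂z(R) + ν̂`). [Silverman AEC VII.2.2
("`E₁(K)` is a subgroup")] [cite: SilvermanAEC2009, VII.2.2] -/
theorem isInReductionKernel_add {P Q : V.toAffine.Point} (hP : V.IsInReductionKernel P)
    (hQ : V.IsInReductionKernel Q) : V.IsInReductionKernel (P + Q) := by
  rcases P with _ | ⟨x₁, y₁, h₁⟩
  · rw [show (Affine.Point.zero : V.toAffine.Point) = 0 from rfl, zero_add]; exact hQ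
  rcases Q with _ | ⟨x₂, y₂, h₂⟩
  · rw [show (Affine.Point.zero : V.toAffine.Point) = 0 from rfl, add_zero]; exact hP
  by_cases hxy : x₁ = x₂ ∧ y₁ = V.toAffine.negY x₂ y₂
  · rw [Affine.Point.add_of_Y_eq hxy.1 hxy.2]; exact V.isInReductionKernel_zero
  · rw [Affine.Point.add_some hxy]
    exact (padicEval₂_formalGroupLaw_of_not_neg_aux h₁ h₂ hP hQ hxy).1

/-- **A chord through the origin of the `(z,w)`-plane**: if the line `w = Lz` passes through
the point `S = (x, y) ∈ E₁(ℚ_p)` (i.e. `L·z(S) = w(S)`), then the third root `-z(S) - c₂/c₃` of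
the chord cubic is `z(-S)` (the line through `O` and `S` meets `E` again in `-S`; when `S = -S`
the line is the tangent and `z(S)` is a double root). [Silverman AEC IV.1, III.2.3] [folklore] -/
theorem origin_third_root {x y L : ℚ_[p]} (h : V.toAffine.Nonsingular x y) (hx : 1 < ‖x‖)
    (hL : L * (-x / y) = -1 / y) (hc3 : 1 + V.a₂ * L + V.a₄ * L ^ 2 + V.a₆ * L ^ 3 ≠ 0) :
    -(-x / y) - (V.a₁ * L + V.a₃ * L ^ 2) / (1 + V.a₂ * L + V.a₄ * L ^ 2 + V.a₆ * L ^ 3) =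
      -x / V.toAffine.negY x y := by
  obtain ⟨hy0, hs0, hs1, -, hneg⟩ := V.param_facts h.1 hx
  have hx0 : x ≠ 0 := fun h0 => by rw [h0, norm_zero] at hx; exact not_lt.mpr zero_le_one hx
  set s : ℚ_[p] := -x / y with hsdef
  set y' : ℚ_[p] := V.toAffine.negY x y with hy'def
  have hy'0 : y' ≠ 0 := by
    intro h0; apply hneg; rw [hy'def, Affine.negY] at h0; linear_combination -h0
  set s' : ℚ_[p] := -x / y' with hs'def
  have hs'0 : s' ≠ 0 := div_ne_zero (neg_ne_zero.mpr hx0) hy'0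
  have heq' : V.toAffine.Equation x y' := (Affine.equation_neg x y).mpr h.1
  have hLx : L * x = 1 := by
    have h0 := hL
    rw [hsdef, mul_div_assoc', div_eq_div_iff hy0 hy0] at h0
    apply mul_right_cancel₀ hy0
    linear_combination -h0
  have hL' : L * s' = -1 / y' := by
    rw [hs'def, mul_div_assoc', div_eq_div_iff hy'0 hy'0]
    linear_combination (-y') * hLx
  -- both `S` and `-S` are roots of the chord cubic (with `ν = 0`)
  have hru : (1 + V.a₂ * L + V.a₄ * L ^ 2 + V.a₆ * L ^ 3) * s ^ 3 +
      (V.a₁ * L + V.a₃ * L ^ 2) * s ^ 2 + (-L) * s = 0 := by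
    have := V.chord_cubic_root (V.chart_point h.1 hy0) (show -1 / y = L * s + 0 by
      rw [add_zero]; exact hL.symm)
    linear_combination this
  have hrv : (1 + V.a₂ * L + V.a₄ * L ^ 2 + V.a₆ * L ^ 3) * s' ^ 3 +
      (V.a₁ * L + V.a₃ * L ^ 2) * s' ^ 2 + (-L) * s' = 0 := by
    have := V.chord_cubic_root (V.chart_point heq' hy'0) (show -1 / y' = L * s' + 0 by
      rw [add_zero]; exact hL'.symm)
    linear_combination this
  by_cases hss : s = s'
  · -- `S` is `2`-torsion: the line is the tangent at `S`
    have hyy : y = y' := by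
      rw [hsdef, hs'def, div_eq_div_iff hy0 hy'0] at hss
      have : -x * (y' - y) = 0 := by linear_combination hss
      have := (mul_eq_zero.mp this).resolve_left (neg_ne_zero.mpr hx0)
      linear_combination -this
    have hFy : 2 * y + V.a₁ * x + V.a₃ = 0 := by
      rw [hy'def, Affine.negY] at hyy; linear_combination hyy
    have hFx : V.a₁ * y - 3 * x ^ 2 - 2 * V.a₂ * x - V.a₄ ≠ 0 := by
      rcases ((Affine.nonsingular_iff' x y).mp h).2 with hX | hY
      · intro h0; apply hX; linear_combination h0
      · exact absurd hFy hY
    set D := padicEval (d⁄dX ℚ_[p] V.formalW) s with hDdef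
    have hder := V.padicEval_derivative_formalW_mul h.1 hx
    rw [← hsdef, ← hDdef] at hder
    have hDL : D = L := by
      have h0 : (D - L) * (s * (V.a₁ * y - 3 * x ^ 2 - 2 * V.a₂ * x - V.a₄)) = 0 := by
        linear_combination hder + D * hFy - (V.a₁ * y - 3 * x ^ 2 - 2 * V.a₂ * x - V.a₄) * hL
      exact sub_eq_zero.mp ((mul_eq_zero.mp h0).resolve_right (mul_ne_zero hs0 hFx))
    have hdereq := V.padicEval_derivative_formalW_eq h.1 hx
    rw [← hsdef, ← hDdef, hDL, show (-1 : ℚ_[p]) / y = L * s from hL.symm] at hdereq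
    have hder2 : L * (1 - (V.a₁ * s + V.a₂ * s ^ 2 + 2 * V.a₃ * (L * s) + 2 * V.a₄ * s * (L * s) +
        3 * V.a₆ * (L * s) ^ 2)) =
        3 * s ^ 2 + V.a₁ * (L * s) + 2 * V.a₂ * s * (L * s) + V.a₄ * (L * s) ^ 2 := by
      linear_combination hdereq
    have hdouble := V.chord_origin_double hs0 hru hder2
    rw [← hss]
    have key : (V.a₁ * L + V.a₃ * L ^ 2) / (1 + V.a₂ * L + V.a₄ * L ^ 2 + V.a₆ * L ^ 3) =
        -2 * s := by
      rw [div_eq_iff hc3]; linear_combination hdouble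
    rw [key]; ring
  · have hvieta := V.chord_origin_vieta hs0 hs'0 hss hru hrv
    have key : (V.a₁ * L + V.a₃ * L ^ 2) / (1 + V.a₂ * L + V.a₄ * L ^ 2 + V.a₆ * L ^ 3) =
        -s - s' := by
      rw [div_eq_iff hc3]; linear_combination hvieta
    rw [key]; ring

/-- **The case `Q = -P`: `F(z(P), z(-P)) = 0 = z(O)`.** The chord is the line through the
origin of the `(z,w)`-plane (it is `x = x(P)` in the `(x,y)`-plane), so `ν = 0` and the third
root is `0`. [Silverman AEC IV.1 (`F(z, i(z)) = 0`)] [folklore] -/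
theorem padicEval₂_formalGroupLaw_of_Y_eq {x₁ y₁ x₂ y₂ : ℚ_[p]}
    (h₁ : V.toAffine.Nonsingular x₁ y₁) (h₂ : V.toAffine.Nonsingular x₂ y₂) (hx₁ : 1 < ‖x₁‖)
    (hx₂ : 1 < ‖x₂‖) (hx : x₁ = x₂) (hy : y₁ = V.toAffine.negY x₂ y₂) :
    padicEval₂ V.formalGroupLaw (-x₁ / y₁) (-x₂ / y₂) = 0 := by
  subst hx
  obtain ⟨hy₁, hu0, hu1, -, -⟩ := V.param_facts h₁.1 hx₁
  obtain ⟨hy₂, hv0, hv1, -, hneg₂⟩ := V.param_facts h₂.1 hx₂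
  have hx0 : x₁ ≠ 0 := fun h0 => by rw [h0, norm_zero] at hx₁; exact not_lt.mpr zero_le_one hx₁
  set u : ℚ_[p] := -x₁ / y₁ with hudef
  set v : ℚ_[p] := -x₁ / y₂ with hvdef
  set L := padicEval₂ V.formalSlope u v with hLdef
  set N := padicEval₂ V.formalIntercept u v with hNdef
  have hwu : padicEval V.formalW u = -1 / y₁ := V.padicEval_formalW_eq h₁.1 hx₁
  have hwv : padicEval V.formalW v = -1 / y₂ := V.padicEval_formalW_eq h₂.1 hx₂
  have hN : N = -1 / y₁ - L * u := by rw [hNdef, padicEval₂_formalIntercept hu1 hv1, hwu]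
  have hchord : L * (v - u) = -1 / y₂ - -1 / y₁ := by
    rw [← hwu, ← hwv]; exact padicEval₂_formalSlope_mul_sub hu1 hv1
  have hc3 := chordDenom_ne_zero (V := V) hu1 hv1
  rw [← hLdef] at hc3
  -- `y₂ = negY x₁ y₁`, so `v = z(-P)`
  have hy₂' : y₂ = V.toAffine.negY x₁ y₁ := by rw [hy, Affine.negY_negY]
  -- the chord passes through the origin: `N = 0` and `L u = w(P)`
  have hNL : N = 0 := by
    by_cases huv : u = v
    · -- `P = -P`: tangent at a `2`-torsion point
      have hyy : y₁ = y₂ := by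
        rw [hudef, hvdef, div_eq_div_iff hy₁ hy₂] at huv
        have : -x₁ * (y₂ - y₁) = 0 := by linear_combination huv
        have := (mul_eq_zero.mp this).resolve_left (neg_ne_zero.mpr hx0)
        linear_combination -this
      have hFy : 2 * y₁ + V.a₁ * x₁ + V.a₃ = 0 := by
        rw [← hyy, Affine.negY] at hy; linear_combination hy
      have hFx : V.a₁ * y₁ - 3 * x₁ ^ 2 - 2 * V.a₂ * x₁ - V.a₄ ≠ 0 := by
        rcases ((Affine.nonsingular_iff' x₁ y₁).mp h₁).2 with hX | hY
        · intro h0; apply hX; linear_combination h0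
        · exact absurd hFy hY
      have hLd : L = padicEval (d⁄dX ℚ_[p] V.formalW) u := by
        rw [hLdef, ← huv]; exact padicEval₂_formalSlope_diag hu1
      have hder := V.padicEval_derivative_formalW_mul h₁.1 hx₁
      rw [← hudef, ← hLd] at hder
      -- `L u Fx = w Fx`, so `L u = w` and `N = 0`
      have h0 : N * (V.a₁ * y₁ - 3 * x₁ ^ 2 - 2 * V.a₂ * x₁ - V.a₄) = 0 := by
        rw [hN]; linear_combination -hder - L * hFy
      exact (mul_eq_zero.mp h0).resolve_right hFx
    · -- genuine chord through `P`, `-P` and `O`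
      have hxeq : u * (-1 / y₂) = v * (-1 / y₁) := by rw [hudef, hvdef]; ring
      have h0 : N * (v - u) = 0 := by rw [hN]; linear_combination hxeq - u * hchord
      exact (mul_eq_zero.mp h0).resolve_right (sub_ne_zero.mpr (Ne.symm huv))
  have hLu : L * u = -1 / y₁ := by linear_combination hN - hNL
  have hthird := V.origin_third_root h₁ hx₁ (by rw [← hudef]; exact hLu) hc3
  -- `z₃(u, v) = z(-P) - ... = 0`
  have hz3 : padicEval₂ V.formalChordZ u v = 0 := by
    rw [padicEval₂_formalChordZ hu1 hv1, padicEval₂_formalChordNum hu1 hv1,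
      padicEval₂_formalChordDenom hu1 hv1, ← hLdef, ← hNdef, hNL, ← div_eq_mul_inv]
    rw [← hudef, ← hy₂', ← hvdef] at hthird
    linear_combination hthird
  rw [padicEval₂_formalGroupLaw hu1 hv1, hz3, padicEval_zero_right, V.constantCoeff_formalNeg]

/-- **The case `P = O`: `F(0, z(Q)) = z(Q)`.** The chord is the line through the origin and
`Q`; its third root is `z(-Q)`, and `i(z(-Q)) = z(Q)`. [Silverman AEC IV.2 (`F(0, Y) = Y`)]
[folklore] -/
theorem padicEval₂_formalGroupLaw_zero_left {x y : ℚ_[p]} (h : V.toAffine.Nonsingular x y)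
    (hx : 1 < ‖x‖) : padicEval₂ V.formalGroupLaw 0 (-x / y) = -x / y := by
  obtain ⟨hy0, hv0, hv1, -, hneg⟩ := V.param_facts h.1 hx
  have h01 : ‖(0 : ℚ_[p])‖ < 1 := by rw [norm_zero]; exact one_pos
  set v : ℚ_[p] := -x / y with hvdef
  set L := padicEval₂ V.formalSlope 0 v with hLdef
  set N := padicEval₂ V.formalIntercept 0 v with hNdef
  have hw0 : padicEval V.formalW 0 = 0 := by rw [padicEval_zero_right, V.constantCoeff_formalW]
  have hwv : padicEval V.formalW v = -1 / y := V.padicEval_formalW_eq h.1 hx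
  have hN : N = 0 := by rw [hNdef, padicEval₂_formalIntercept h01 hv1, hw0, mul_zero, sub_zero]
  have hLv : L * v = -1 / y := by
    have := padicEval₂_formalSlope_mul_sub (V := V) h01 hv1
    rw [← hLdef, hw0, hwv, sub_zero, sub_zero] at this
    exact this
  have hc3 := chordDenom_ne_zero (V := V) h01 hv1
  rw [← hLdef] at hc3
  have hthird := V.origin_third_root h hx (by rw [← hvdef]; exact hLv) hc3
  have heq' : V.toAffine.Equation x (V.toAffine.negY x y) := (Affine.equation_neg x y).mpr h.1
  have hz3 : padicEval₂ V.formalChordZ 0 v = -x / V.toAffine.negY x y := by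
    rw [padicEval₂_formalChordZ h01 hv1, padicEval₂_formalChordNum h01 hv1,
      padicEval₂_formalChordDenom h01 hv1, ← hLdef, ← hNdef, hN, ← div_eq_mul_inv]
    rw [← hvdef] at hthird
    linear_combination hthird
  rw [padicEval₂_formalGroupLaw h01 hv1, hz3, V.padicEval_formalNeg_eq heq' hx, Affine.negY_negY]

/-- **The case `Q = O`: `F(z(P), 0) = z(P)`.** [Silverman AEC IV.2 (`F(X, 0) = X`)] [folklore] -/
theorem padicEval₂_formalGroupLaw_zero_right {x y : ℚ_[p]} (h : V.toAffine.Nonsingular x y)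
    (hx : 1 < ‖x‖) : padicEval₂ V.formalGroupLaw (-x / y) 0 = -x / y := by
  obtain ⟨hy0, hu0, hu1, -, hneg⟩ := V.param_facts h.1 hx
  have h01 : ‖(0 : ℚ_[p])‖ < 1 := by rw [norm_zero]; exact one_pos
  set u : ℚ_[p] := -x / y with hudef
  set L := padicEval₂ V.formalSlope u 0 with hLdef
  set N := padicEval₂ V.formalIntercept u 0 with hNdef
  have hw0 : padicEval V.formalW 0 = 0 := by rw [padicEval_zero_right, V.constantCoeff_formalW]
  have hwu : padicEval V.formalW u = -1 / y := V.padicEval_formalW_eq h.1 hx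
  have hLu : L * u = -1 / y := by
    have := padicEval₂_formalSlope_mul_sub (V := V) hu1 h01
    rw [← hLdef, hw0, hwu, zero_sub, zero_sub] at this
    linear_combination -this
  have hN : N = 0 := by
    rw [hNdef, padicEval₂_formalIntercept hu1 h01, hwu, ← hLdef]; linear_combination -hLu
  have hc3 := chordDenom_ne_zero (V := V) hu1 h01
  rw [← hLdef] at hc3
  have hthird := V.origin_third_root h hx (by rw [← hudef]; exact hLu) hc3
  have heq' : V.toAffine.Equation x (V.toAffine.negY x y) := (Affine.equation_neg x y).mpr h.1
  have hz3 : padicEval₂ V.formalChordZ u 0 = -x / V.toAffine.negY x y := by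
    rw [padicEval₂_formalChordZ hu1 h01, padicEval₂_formalChordNum hu1 h01,
      padicEval₂_formalChordDenom hu1 h01, ← hLdef, ← hNdef, hN, ← div_eq_mul_inv]
    rw [← hudef] at hthird
    linear_combination hthird
  rw [padicEval₂_formalGroupLaw hu1 h01, hz3, V.padicEval_formalNeg_eq heq' hx, Affine.negY_negY]

omit hV in
/-- `F(0, 0) = 0`. [folklore] -/
theorem _root_.Literature.NumberTheory.EllipticCurves.padicEval₂_zero_zero
    (F : MvPowerSeries (Fin 2) ℚ_[p]) : padicEval₂ F 0 0 = MvPowerSeries.constantCoeff F := by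
  classical
  unfold padicEval₂
  rw [tsum_eq_single 0 fun d hd => ?_]
  · simp
  · have : d 0 ≠ 0 ∨ d 1 ≠ 0 := by
      by_contra hcon
      push Not at hcon
      apply hd; ext i; fin_cases i <;> simp [hcon.1, hcon.2]
    rcases this with h0 | h1
    · rw [zero_pow h0, zero_mul, mul_zero]
    · rw [zero_pow h1, mul_zero, mul_zero]

/-! ### Discharge of the named fact -/

/-- **Discharge of `WeierstrassCurve.formalGroupLaw_padicEval` (θ₃).** For an elliptic curve
over `ℚ_p` with `p`-integral Weierstrass equation and `P, Q ∈ E₁(ℚ_p)`, the chord–tangent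
formal group law evaluated at the parameters is the parameter of the chord–tangent sum:
`F(z(P), z(Q)) = z(P + Q)` — by cases `P = O`, `Q = O`, `P = -Q`, and the generic case.
[Silverman AEC IV.1 (pp. 116–118), VII.2.2] [cite: SilvermanAEC2009, VII.2.2] -/
theorem formalGroupLaw_padicEval_holds : formalGroupLaw_padicEval := by
  intro p _ W _ _ P Q hP hQ
  rcases P with _ | ⟨x₁, y₁, h₁⟩ <;> rcases Q with _ | ⟨x₂, y₂, h₂⟩
  · show padicEval₂ W.formalGroupLaw 0 0 = 0
    rw [padicEval₂_zero_zero, W.constantCoeff_formalGroupLaw]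
  · show padicEval₂ W.formalGroupLaw 0 (-x₂ / y₂) = -x₂ / y₂
    exact padicEval₂_formalGroupLaw_zero_left h₂ hQ
  · show padicEval₂ W.formalGroupLaw (-x₁ / y₁) 0 = -x₁ / y₁
    exact padicEval₂_formalGroupLaw_zero_right h₁ hP
  · show padicEval₂ W.formalGroupLaw (-x₁ / y₁) (-x₂ / y₂) = W.formalParameter (_ + _)
    by_cases hxy : x₁ = x₂ ∧ y₁ = W.toAffine.negY x₂ y₂
    · rw [Affine.Point.add_of_Y_eq hxy.1 hxy.2]
      exact padicEval₂_formalGroupLaw_of_Y_eq h₁ h₂ hP hQ hxy.1 hxy.2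
    · exact padicEval₂_formalGroupLaw_of_not_neg h₁ h₂ hP hQ hxy

/-- **The theta relation at points from θ₁ and θ₂ alone** (θ₃ discharged).
[Mazur–Tate 1991, Thm. 3.1; Blakestad–Grant 2023, Prop. 14, Thm. 15] [folklore] -/
theorem padicSigma_theta_of_MT_theta (hMT : mazur_tate_sigma_existsUnique)
    (hθ : padicSigma_theta_formal) : padicSigma_theta :=
  padicSigma_theta_of_formal hMT hθ formalGroupLaw_padicEval_holds

/-- **Existence of the canonical `p`-adic height datum from θ₁ (existence of the Mazur–Tate pair,
MST 2006 Thm. 1.3) and θ₂ (the formal theta identity, Blakestad–Grant 2023 Prop. 14 /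
MT 1991 Thm. 3.1)** — the two named facts now behind `WeierstrassCurve.exists_isCanonical`.
[Mazur–Stein–Tate 2006, §2.7; Stein–Wuthrich 2013, §4.1 eq. (4.1)] [cite: MazurSteinTate2006, §2.7] -/
theorem exists_isCanonical_of_MT_theta (hMT : mazur_tate_sigma_existsUnique)
    (hθ : padicSigma_theta_formal) : exists_isCanonical :=
  exists_isCanonical_of_formal hMT hθ formalGroupLaw_padicEval_holds

/-- The same with uniqueness, given admissible multiples. [Mazur–Stein–Tate 2006, §1] [folklore] -/
theorem existsUnique_isCanonical_of_MT_theta (hMT : mazur_tate_sigma_existsUnique)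
    (hθ : padicSigma_theta_formal) (hS : exists_admissible_nsmul) (W : WeierstrassCurve ℚ)
    [W.IsElliptic] [W.IsGloballyMinimal] (p : ℕ) [Fact p.Prime] (hp : 5 ≤ p)
    (hgood : W.HasGoodReductionAtPrime p) (hord : ¬ (p : ℤ) ∣ W.frobeniusTrace p) :
    ∃! D : PAdicHeightData W p, D.IsCanonical :=
  existsUnique_isCanonical_of_formal hMT hθ formalGroupLaw_padicEval_holds hS W p hp hgood hord

end Main

end WeierstrassCurve
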